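import Summits.ValiantsHypothesis.ValiantsHypothesis.Theorems.LacunarySymmetroidMatrixDescartesPivotArrowSixKit

/-!
# `MatrixDescartes` (stmt-ValiantsHypothesis-18050) — pivot column at all sizes, GENERIC kit: the scalar model of a
# stacked arrowhead construction whose block shape crosses its level TWICE (the `K = 2` column)

HONEST FRAMING.  Cell `pub-symmetroid`, seat `val-sym-mdr-p2` (gen 8); helper file `--supports` the crux
`Theses.LacunarySymmetroid.MatrixDescartes` (OPEN), NO closure claim.  Pure one-variable real analysis, generic in the block
shape: the soft induction of `…PivotArrowSixKit` with TWO sign points instead of six: an ABSTRACT shape function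
`φ : ℝ → ℝ` with `φ → 0` at `0` and at `∞` and values `< θ, > θ` at two points `p₁ > p₂ > 0` (`θ > 0`).  It is
instantiated in `…PivotArrowTwo` by the `K = 2` balanced arrowhead block (target row: conjb-1's `Pivot.PivotRootLawAt m 2 1 B`,
the index-ONE column of the V-law format).  Nothing here bears on `MatrixDescartes`
in its window, on `stub_twoSided`, `DoorA26` / `DoorA34`, the census registers, or `VP ≠ VNP`.

THE MODEL `M(x) = x⁻³ − 1 + ∑ᵢ Uᵢ φ(x/Ξᵢ)` and THE INDUCTION (`PivotArrowTwo.model_alternates`): for every `k` there are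
positive `Ξ, U : Fin k → ℝ` and a strictly decreasing list of `2k + 2` positive points along which `M` has the signs
`−, +, −, …, +` (from the largest point down); step: amplitude `U' := 1/θ`, new scale `Ξ' → ∞`, two new points `p₁Ξ' > p₂Ξ'`,
finitely many eventual strict inequalities (`Filter.eventually_all`).  No quantitative estimate anywhere.

[folklore] Elementary real analysis over Mathlib.  Axioms `propext`, `Classical.choice`, `Quot.sound`.
-/

set_option linter.dupNamespace false

namespace Summit.ValiantsHypothesis.ValiantsHypothesis.Theorems.LacunarySymmetroidMatrixDescartes

open scoped BigOperators Topology
open Filter Matrix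

namespace PivotArrowTwo

/-- The scalar model `M(x) = x⁻³ − 1 + ∑ᵢ Uᵢ φ(x / Ξᵢ)` for a block shape `φ` (local notation, no definition). -/
local notation3 (prettyPrint := false) "M⟦" φ ", " Ξ ", " U "⟧(" x ")" =>
  ((x : ℝ)⁻¹ ^ 3 - 1 + ∑ i, (U : Fin _ → ℝ) i * (φ : ℝ → ℝ) ((x : ℝ) / (Ξ : Fin _ → ℝ) i))

/-! The limit lemmas for the model (`model_snoc`, `model_tendsto_atTop`, `tendsto_newBlock_zero`,
`tendsto_model_newPoint`) are the generic ones of `…PivotArrowSixKit` (namespace `PivotArrowSix`). -/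

/-! ## Sign bookkeeping along `vecCons` -/

/-- Prepending two points with signs `−, +` to an alternating list keeps it alternating (the parity of the old indices
is unchanged). [bookkeeping] -/
theorem alt_cons₂ {m : ℕ} (f : ℝ → ℝ) (σ : Fin (m + 1) → ℝ) {a b : ℝ} (ha : f a < 0) (hb : 0 < f b)
    (hσ : ∀ j : Fin (m + 1), 0 < (-1 : ℝ) ^ ((j : ℕ) + 1) * f (σ j)) :
    ∀ j : Fin (m + 1 + 1 + 1), 0 < (-1 : ℝ) ^ ((j : ℕ) + 1) * f (vecCons a (vecCons b σ) j) := by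
  intro j
  refine Fin.cases ?_ (fun j => ?_) j
  · simp only [Fin.val_zero, Matrix.cons_val_zero]
    norm_num
    exact ha
  refine Fin.cases ?_ (fun j => ?_) j
  · simp only [Fin.val_succ, Fin.val_zero, Matrix.cons_val_succ, Matrix.cons_val_zero]
    norm_num
    exact hb
  have h := hσ j
  have h2 : (-1 : ℝ) ^ ((j : ℕ) + 1 + 1 + 1) = (-1 : ℝ) ^ ((j : ℕ) + 1) := by ring
  simp only [Fin.val_succ, Matrix.cons_val_succ]
  rw [h2]
  exact h

/-- All entries positive after prepending two positive points. [bookkeeping] -/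
theorem pos_cons₂ {m : ℕ} (σ : Fin (m + 1) → ℝ) {a b : ℝ} (ha : 0 < a) (hb : 0 < b) (hσ : ∀ j, 0 < σ j) :
    ∀ j : Fin (m + 1 + 1 + 1), 0 < (vecCons a (vecCons b σ)) j := by
  intro j
  refine Fin.cases ?_ (fun j => ?_) j
  · simpa using ha
  refine Fin.cases ?_ (fun j => ?_) j
  · simpa using hb
  simpa [Matrix.cons_val_succ] using hσ j

/-! ## The induction step -/

section Step

variable (φ : ℝ → ℝ) (hφ0 : Tendsto φ (𝓝 0) (𝓝 0)) (hφinf : Tendsto φ atTop (𝓝 0))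
  {θ p₁ p₂ : ℝ} (hθ : 0 < θ) (h21 : p₂ < p₁) (hp2 : 0 < p₂) (s₁ : φ p₁ < θ) (s₂ : θ < φ p₂)

include hφ0 hφinf hθ h21 hp2 s₁ s₂

/-- **One more block.**  Given positive scales `Ξ : Fin k → ℝ`, amplitudes `U`, and a strictly decreasing list `σ` of
positive points along which the model alternates `−, +, −, …` (from the largest point), there are `Ξ', U' > 0` such
that the extended model (new block of scale `Ξ'`, amplitude `U' = 1/θ`) alternates along the list extended by the two
points `p₁Ξ' > p₂Ξ'` on top. [folklore] -/
theorem step {k m : ℕ} (Ξ U : Fin k → ℝ) (hΞ : ∀ i, 0 < Ξ i)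
    (σ : Fin (m + 1) → ℝ) (hanti : StrictAnti σ) (hpos : ∀ j, 0 < σ j)
    (hsign : ∀ j : Fin (m + 1), 0 < (-1 : ℝ) ^ ((j : ℕ) + 1) * M⟦φ, Ξ, U⟧(σ j)) :
    ∃ Ξ' U' : ℝ, 0 < Ξ' ∧ 0 < U' ∧
      StrictAnti (vecCons (p₁ * Ξ') (vecCons (p₂ * Ξ') σ)) ∧
      (∀ j, 0 < (vecCons (p₁ * Ξ') (vecCons (p₂ * Ξ') σ)) j) ∧
      ∀ j : Fin (m + 1 + 1 + 1), 0 < (-1 : ℝ) ^ ((j : ℕ) + 1) *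
        M⟦φ, Fin.snoc Ξ Ξ', Fin.snoc U U'⟧((vecCons (p₁ * Ξ') (vecCons (p₂ * Ξ') σ)) j) := by
  obtain ⟨U', hU'⟩ : ∃ U' : ℝ, U' = 1 / θ := ⟨_, rfl⟩
  have hU'pos : 0 < U' := by rw [hU']; positivity
  -- (E1) old points keep their signs
  have E1 : ∀ j : Fin (m + 1), ∀ᶠ Ξ' : ℝ in atTop,
      0 < (-1 : ℝ) ^ ((j : ℕ) + 1) * (M⟦φ, Ξ, U⟧(σ j) + U' * φ (σ j / Ξ')) := by
    intro j
    have ht : Tendsto (fun Ξ' : ℝ => (-1 : ℝ) ^ ((j : ℕ) + 1) * (M⟦φ, Ξ, U⟧(σ j) + U' * φ (σ j / Ξ')))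
        atTop (𝓝 ((-1 : ℝ) ^ ((j : ℕ) + 1) * (M⟦φ, Ξ, U⟧(σ j) + 0))) :=
      ((PivotArrowSix.tendsto_newBlock_zero φ hφ0 (σ j) U').const_add _).const_mul _
    rw [add_zero] at ht
    exact ht.eventually_const_lt (hsign j)
  -- (E2) the new points
  have E2 : ∀ y : ℝ, 0 < y → ∀ c : ℝ, c < -1 + U' * φ y →
      ∀ᶠ Ξ' : ℝ in atTop, c < M⟦φ, Ξ, U⟧(y * Ξ') + U' * φ (y * Ξ' / Ξ') := by
    intro y hy c hc
    have ht : Tendsto (fun Ξ' : ℝ => M⟦φ, Ξ, U⟧(y * Ξ') + U' * φ (y * Ξ' / Ξ')) atTop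
        (𝓝 (-1 + U' * φ y)) := by
      refine ((PivotArrowSix.tendsto_model_newPoint φ hφinf Ξ U hΞ hy).add_const (U' * φ y)).congr' ?_
      filter_upwards [eventually_gt_atTop (0 : ℝ)] with Ξ' hΞ'
      rw [mul_div_cancel_right₀ y hΞ'.ne']
    exact ht.eventually_const_lt hc
  have E2' : ∀ y : ℝ, 0 < y → ∀ c : ℝ, -1 + U' * φ y < c →
      ∀ᶠ Ξ' : ℝ in atTop, M⟦φ, Ξ, U⟧(y * Ξ') + U' * φ (y * Ξ' / Ξ') < c := by
    intro y hy c hc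
    have ht : Tendsto (fun Ξ' : ℝ => M⟦φ, Ξ, U⟧(y * Ξ') + U' * φ (y * Ξ' / Ξ')) atTop
        (𝓝 (-1 + U' * φ y)) := by
      refine ((PivotArrowSix.tendsto_model_newPoint φ hφinf Ξ U hΞ hy).add_const (U' * φ y)).congr' ?_
      filter_upwards [eventually_gt_atTop (0 : ℝ)] with Ξ' hΞ'
      rw [mul_div_cancel_right₀ y hΞ'.ne']
    exact ht.eventually_lt_const hc
  -- the signs of the six limiting values: `-1 + φ(p)/θ`
  have key : ∀ p : ℝ, -1 + U' * φ p = (φ p - θ) / θ := by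
    intro p
    rw [hU']
    field_simp
    ring
  have t₁ : -1 + U' * φ p₁ < 0 := by rw [key]; exact div_neg_of_neg_of_pos (by linarith) hθ
  have t₂ : (0 : ℝ) < -1 + U' * φ p₂ := by rw [key]; exact div_pos (by linarith) hθ
  have hp1 : 0 < p₁ := hp2.trans h21
  -- collect finitely many eventual facts and pick `Ξ'`
  obtain ⟨Ξ', hΞ'pos, hΞ'big, hold, hn1, hn2⟩ :
      ∃ Ξ' : ℝ, 0 < Ξ' ∧ σ 0 / p₂ < Ξ' ∧
        (∀ j : Fin (m + 1), 0 < (-1 : ℝ) ^ ((j : ℕ) + 1) * (M⟦φ, Ξ, U⟧(σ j) + U' * φ (σ j / Ξ'))) ∧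
        M⟦φ, Ξ, U⟧(p₁ * Ξ') + U' * φ (p₁ * Ξ' / Ξ') < 0 ∧
        0 < M⟦φ, Ξ, U⟧(p₂ * Ξ') + U' * φ (p₂ * Ξ' / Ξ') := by
    have hall : ∀ᶠ Ξ' : ℝ in atTop, 0 < Ξ' ∧ σ 0 / p₂ < Ξ' ∧
        (∀ j : Fin (m + 1), 0 < (-1 : ℝ) ^ ((j : ℕ) + 1) * (M⟦φ, Ξ, U⟧(σ j) + U' * φ (σ j / Ξ'))) ∧
        M⟦φ, Ξ, U⟧(p₁ * Ξ') + U' * φ (p₁ * Ξ' / Ξ') < 0 ∧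
        0 < M⟦φ, Ξ, U⟧(p₂ * Ξ') + U' * φ (p₂ * Ξ' / Ξ') := by
      refine (eventually_gt_atTop 0).and ((eventually_gt_atTop _).and ((eventually_all.2 E1).and
        ((E2' p₁ hp1 0 t₁).and (E2 p₂ hp2 0 t₂))))
    exact hall.exists
  have hσ0 : σ 0 < p₂ * Ξ' := by
    have := (div_lt_iff₀ hp2).1 hΞ'big
    linarith
  refine ⟨Ξ', U', hΞ'pos, hU'pos, ?_, ?_, ?_⟩
  · -- strictly decreasing
    exact StrictAnti.vecCons (StrictAnti.vecCons hanti hσ0) (mul_lt_mul_of_pos_right h21 hΞ'pos)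
  · exact pos_cons₂ σ (mul_pos hp1 hΞ'pos) (mul_pos hp2 hΞ'pos) hpos
  · refine alt_cons₂ (fun x => M⟦φ, Fin.snoc Ξ Ξ', Fin.snoc U U'⟧(x)) σ ?_ ?_ ?_
    · rw [PivotArrowSix.model_snoc]; simpa using hn1
    · rw [PivotArrowSix.model_snoc]; simpa using hn2
    · intro j
      rw [PivotArrowSix.model_snoc]
      exact hold j

/-- **THE SCALAR MODEL ALTERNATES `2k + 2` TIMES.**  For every `k` there are positive scales and amplitudes
`Ξ, U : Fin k → ℝ` and a strictly decreasing list of `2k + 2` positive points along which the model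
`x⁻³ − 1 + ∑ᵢ Uᵢ φ(x/Ξᵢ)` has the signs `−, +, −, +, …, +` (from the largest point down). [folklore] -/
theorem model_alternates (k : ℕ) :
    ∃ (Ξ U : Fin k → ℝ) (σ : Fin (2 * k + 1 + 1) → ℝ), (∀ i, 0 < Ξ i) ∧ (∀ i, 0 < U i) ∧
      StrictAnti σ ∧ (∀ j, 0 < σ j) ∧
      ∀ j : Fin (2 * k + 1 + 1), 0 < (-1 : ℝ) ^ ((j : ℕ) + 1) * M⟦φ, Ξ, U⟧(σ j) := by
  induction k with
  | zero =>
    refine ⟨Fin.elim0, Fin.elim0, ![2, 1 / 2], fun i => i.elim0, fun i => i.elim0, ?_, ?_, ?_⟩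
    · refine StrictAnti.vecCons (strictAnti_vecEmpty) ?_
      show (1 : ℝ) / 2 < 2
      norm_num
    · intro j
      fin_cases j <;> simp
    · intro j
      fin_cases j <;> simp <;> norm_num
  | succ k ih =>
    obtain ⟨Ξ, U, σ, hΞ, hU, hanti, hpos, hsign⟩ := ih
    obtain ⟨Ξ', U', hΞ', hU', hanti', hpos', hsign'⟩ :=
      step φ hφ0 hφinf hθ h21 hp2 s₁ s₂ Ξ U hΞ σ hanti hpos hsign
    refine ⟨Fin.snoc Ξ Ξ', Fin.snoc U U', vecCons (p₁ * Ξ') (vecCons (p₂ * Ξ') σ), ?_, ?_, hanti', hpos', hsign'⟩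
    · intro i
      refine Fin.lastCases ?_ (fun i => ?_) i
      · simpa using hΞ'
      · simpa using hΞ i
    · intro i
      refine Fin.lastCases ?_ (fun i => ?_) i
      · simpa using hU'
      · simpa using hU i

end Step

end PivotArrowTwo

end Summit.ValiantsHypothesis.ValiantsHypothesis.Theorems.LacunarySymmetroidMatrixDescartes
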